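import Summits.FinalStateConjecture.FinalStateConjecture.Theses.LeakageWritesInInk

/-!
# Birth skeleton of `StripFromProfileDecay` (stmt-FinalStateConjecture-18241) — layer-2 child of `LeakageTimeAnalyticity`, route LeakageWritesInInk

Two stubs: `stub_lowAndPieces` — classical Littlewood–Paley for the pinned kernel: for `f(s) = G(x + s∂₀)(v,w)`,
`f = f₀ + Σ_j f_j` pointwise (dyadic partition `Σ_j χ(ξ/2^j) = 1`), the low part `f₀` restricting an ENTIRE function
bounded by `A₀‖v‖‖w‖e^{B|Im z|}` and each piece `f_j = (P_{2^j} G)(x + ·∂₀)(v,w)` restricting an entire function bounded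
by `A · prof k (2^j) ‖v‖‖w‖ · e^{B 2^j |Im z|}` (Paley–Wiener for the reproducing kernel `P = P̃P`; the sup of the piece
along the orbit is `≤ prof k (2^j)‖v‖‖w‖` by `le_csSup`, `BddAbove` from the hypotheses of X); `stub_dyadicSynthesis`
— ABSTRACT complex analysis (Weierstrass M-test on the strip `|Im z| < c/(2B)`): exponentially small entire pieces of
exponential type `B 2^j` sum to a bounded holomorphic function on a strip, with a bound `K₁ C₀ + K₂ D` LINEAR in the
two size constants. The composition PROVES `0 ≤ prof` (so the decay constant is `≥ 0`) and threads the constants so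
that the strip bound is `(K₁A₀ + K₂AC′)‖v‖‖w‖`, uniform over the cylinder.

Shape (as in `Cruxes/BandFromNonradiation/Lines/birth.lean`): statement defs, sorried stubs `stub_*`, name-keyed aliases
`__Registered.stub_*` (abbrevs), the REAL composition `StripFromProfileDecay_of : __Registered.stub_… → … → StripFromProfileDecay` (conclusion = the
route decl by name), and a wiring `example`.
-/

set_option linter.dupNamespace false

namespace Summit.FinalStateConjecture.FinalStateConjecture.Cruxes.StripFromProfileDecay.Birth

open scoped BigOperators Topology Manifold Classical MeasureTheory ProbabilityTheory Matrix InnerProductSpace ComplexConjugate ContinuousMap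
open Filter Set Function TopologicalSpace MeasureTheory
open Summit.FinalStateConjecture.FinalStateConjecture.Theses.LeakageWritesInInk

/-! ## Statements -/

/-- classical LP reconstruction + Paley–Wiener extension of the low part and of each dyadic piece, sizes measured by the canonical tail profile. -/
def LowAndPieces : Prop :=
  open Literature.Geometry.Lorentzian in ∀ (a r₀ : ℝ) (G : E4 → E4 →L[ℝ] E4 →L[ℝ] ℝ), (0 < r₀ ∧ MetricCoord.IsMetricOn G (Kerr.region a r₀ : Set E4) ∧ (∃ c₀ δ : ℝ, 0 < c₀ ∧ 0 < δ ∧ ∀ x ∈ Kerr.region a r₀, (E4.dx 0) (MetricCoord.sharpAt G x (E4.dx 0)) ≤ -c₀ ∧ (Kerr.radius a x < r₀ + δ → (fderiv ℝ (Kerr.radius a) x) (MetricCoord.sharpAt G x (fderiv ℝ (Kerr.radius a) x)) ≤ -c₀ ∧ c₀ ≤ (E4.dx 0) (MetricCoord.sharpAt G x (fderiv ℝ (Kerr.radius a) x)))) ∧ (∀ x ∈ Kerr.region a r₀, MetricCoord.ricAt G x = 0) ∧ (∀ x ∈ Kerr.region a r₀, ∑ β : Fin 4, MetricCoord.chrAt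 G x (MetricCoord.sharpAt G x (E4.dx β)) (E4.basisVector β) = 0) ∧ (∀ k : ℕ, ∃ C : ℝ, ∀ x ∈ Kerr.region a r₀, ‖iteratedFDeriv ℝ k G x‖ ≤ C ∧ ‖MetricCoord.sharpAt G x‖ ≤ C) ∧ (∃ C : ℝ, ∀ x ∈ Kerr.region a r₀, ‖G x - Minkowski.bilin‖ ≤ C / E4.spatialNorm x ∧ ‖iteratedFDeriv ℝ 1 G x‖ ≤ C / E4.spatialNorm x ^ 2 ∧ ‖iteratedFDeriv ℝ 2 G x‖ ≤ C / E4.spatialNorm x ^ 3)) → ∀ prof : ℕ → ℝ → ℝ, prof = (fun (k : ℕ) (lam : ℝ) => sSup {q : ℝ | ∃ ν : ℝ, lam ≤ ν ∧ ∃ m : ℕ, m ≤ k ∧ ∃ x ∈ Kerr.region a r₀, q = ‖iteratedFDeriv ℝ m (fun y : E4 => ∫ τ : ℝ, (ν * (∫ ξ : ℝ, Real.cos (2 * Real.pi * ξ * (ν * τ)) * (Real.smoothTransition (2 - ξ ^ 2) - Real.smoothTransition (2 - (2 * ξ) ^ 2)))) • G (y + τ • E4.basisVector 0)) x‖}) →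 ∃ (A₀ A B : ℝ), 0 ≤ A₀ ∧ 0 ≤ A ∧ 0 < B ∧ ∀ k : ℕ, ∀ x ∈ Kerr.region a r₀, ∀ v w : E4, ∃ (f₀ : ℝ → ℝ) (fj : ℕ → ℝ → ℝ), (∀ s : ℝ, HasSum (fun j : ℕ => fj j s) (G (x + s • E4.basisVector 0) v w - f₀ s)) ∧ (∃ F₀ : ℂ → ℂ, Differentiable ℂ F₀ ∧ (∀ z : ℂ, ‖F₀ z‖ ≤ A₀ * ‖v‖ * ‖w‖ * Real.exp (B * |z.im|)) ∧ ∀ s : ℝ, F₀ (s : ℂ) = ((f₀ s : ℝ) : ℂ)) ∧ ∀ j : ℕ, ∃ Fj : ℂ → ℂ, Differentiable ℂ Fj ∧ (∀ z : ℂ, ‖Fj z‖ ≤ A * prof k (2 ^ j) * ‖v‖ * ‖w‖ * Real.exp (B * 2 ^ j * |z.im|)) ∧ ∀ s : ℝ, Fj (s : ℂ) = ((fj j s : ℝ) : ℂ)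

/-- abstract complex analysis (provable now): M-test synthesis on a strip with a bound linear in the size constants. -/
def DyadicSynthesis : Prop :=
  ∀ (B c : ℝ), 0 < B → 0 < c → ∃ (K₁ K₂ σ : ℝ), 0 ≤ K₁ ∧ 0 ≤ K₂ ∧ 0 < σ ∧ ∀ (f f₀ : ℝ → ℝ) (fj : ℕ → ℝ → ℝ) (C₀ D : ℝ), 0 ≤ C₀ → 0 ≤ D → (∀ s : ℝ, HasSum (fun j : ℕ => fj j s) (f s - f₀ s)) → (∃ F₀ : ℂ → ℂ, Differentiable ℂ F₀ ∧ (∀ z : ℂ, ‖F₀ z‖ ≤ C₀ * Real.exp (B * |z.im|)) ∧ ∀ s : ℝ, F₀ (s : ℂ) = ((f₀ s : ℝ) : ℂ)) → (∀ j : ℕ, ∃ Fj : ℂ → ℂ, Differentiable ℂ Fj ∧ (∀ z : ℂ, ‖Fj z‖ ≤ D * Real.exp (-(c * 2 ^ j)) * Real.exp (B * 2 ^ j * |z.im|)) ∧ ∀ s : ℝ, Fj (s : ℂ) = ((fj j s : ℝ) : ℂ)) → ∃ F : ℂ → ℂ, DifferentiableOn ℂ F {z : ℂ | |z.im| < σ}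 ∧ (∀ z : ℂ, |z.im| < σ → ‖F z‖ ≤ K₁ * C₀ + K₂ * D) ∧ ∀ s : ℝ, F (s : ℂ) = ((f s : ℝ) : ℂ)

/-! ## Stubs (the only `sorry`s) -/

/-- stub `stub_lowAndPieces` : `LowAndPieces` (the only sorries of the file are the stubs). -/
theorem stub_lowAndPieces : LowAndPieces := by
  sorry

/-- stub `stub_dyadicSynthesis` : `DyadicSynthesis` (the only sorries of the file are the stubs). -/
theorem stub_dyadicSynthesis : DyadicSynthesis := by
  sorry

namespace __Registered

/-- Alias of `LowAndPieces` keyed by the registered stub name. -/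
abbrev stub_lowAndPieces : Prop := LowAndPieces
/-- Alias of `DyadicSynthesis` keyed by the registered stub name. -/
abbrev stub_dyadicSynthesis : Prop := DyadicSynthesis

end __Registered

/-- **Composition** (real proof, no sorry). -/
theorem StripFromProfileDecay_of :
    __Registered.stub_lowAndPieces → __Registered.stub_dyadicSynthesis →
      Summit.FinalStateConjecture.FinalStateConjecture.Theses.LeakageWritesInInk.StripFromProfileDecay := by
  intro hL hS a r₀ G hG prof hprof hexp
  obtain ⟨k, c, C', hc, hdec⟩ := hexp
  obtain ⟨A₀, A, B, hA₀, hA, hB, hLP⟩ := hL a r₀ G hG prof hprof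
  obtain ⟨K₁, K₂, σ, hK₁, hK₂, hσ, hsyn⟩ := hS B c hB hc
  -- the canonical profile is nonnegative (an `sSup` of norms), so the decay constant is `≥ 0`
  have hprof_nonneg : ∀ lam : ℝ, 0 ≤ prof k lam := by
    intro lam
    rw [hprof]
    apply Real.sSup_nonneg
    rintro q ⟨ν, hν, m, hm, x, hx, rfl⟩
    exact norm_nonneg _
  have hC' : 0 ≤ C' := by
    rcases lt_or_ge C' 0 with hneg | hge
    · exfalso
      have h1 := hdec 1 le_rfl
      have h2 : C' * Real.exp (-(c * 1)) < 0 := mul_neg_of_neg_of_pos hneg (Real.exp_pos _)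
      linarith [hprof_nonneg 1]
    · exact hge
  refine ⟨σ, K₁ * A₀ + K₂ * (A * C'), hσ, fun x hx v w => ?_⟩
  obtain ⟨f₀, fj, hsum, hF₀, hFj⟩ := hLP k x hx v w
  have hv : 0 ≤ ‖v‖ := norm_nonneg _
  have hw : 0 ≤ ‖w‖ := norm_nonneg _
  -- the dyadic pieces, with the profile replaced by its exponential bound
  have hpieces : ∀ j : ℕ, ∃ Fj : ℂ → ℂ, Differentiable ℂ Fj ∧
      (∀ z : ℂ, ‖Fj z‖ ≤ A * C' * ‖v‖ * ‖w‖ * Real.exp (-(c * 2 ^ j)) * Real.exp (B * 2 ^ j * |z.im|)) ∧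
      ∀ s : ℝ, Fj (s : ℂ) = ((fj j s : ℝ) : ℂ) := by
    intro j
    obtain ⟨Fj, hFjd, hFjb, hFjr⟩ := hFj j
    refine ⟨Fj, hFjd, fun z => ?_, hFjr⟩
    have h2j : (1 : ℝ) ≤ 2 ^ j := one_le_pow₀ (by norm_num)
    have hpj : prof k (2 ^ j) ≤ C' * Real.exp (-(c * 2 ^ j)) := hdec _ h2j
    calc ‖Fj z‖ ≤ A * prof k (2 ^ j) * ‖v‖ * ‖w‖ * Real.exp (B * 2 ^ j * |z.im|) := hFjb z
      _ ≤ A * (C' * Real.exp (-(c * 2 ^ j))) * ‖v‖ * ‖w‖ * Real.exp (B * 2 ^ j * |z.im|) := by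
          gcongr
      _ = A * C' * ‖v‖ * ‖w‖ * Real.exp (-(c * 2 ^ j)) * Real.exp (B * 2 ^ j * |z.im|) := by ring
  obtain ⟨F, hFd, hFb, hFr⟩ := hsyn (fun s => G (x + s • Literature.Geometry.Lorentzian.E4.basisVector 0) v w)
    f₀ fj (A₀ * ‖v‖ * ‖w‖) (A * C' * ‖v‖ * ‖w‖) (by positivity) (by positivity) hsum hF₀ hpieces
  refine ⟨F, hFd, fun z hz => ?_, hFr⟩
  calc ‖F z‖ ≤ K₁ * (A₀ * ‖v‖ * ‖w‖) + K₂ * (A * C' * ‖v‖ * ‖w‖) := hFb z hz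
    _ = (K₁ * A₀ + K₂ * (A * C')) * ‖v‖ * ‖w‖ := by ring

/-- WIRING CHECK (an `example`: no pre-composed witness enters the environment). -/
example : Summit.FinalStateConjecture.FinalStateConjecture.Theses.LeakageWritesInInk.StripFromProfileDecay :=
  StripFromProfileDecay_of stub_lowAndPieces stub_dyadicSynthesis

end Summit.FinalStateConjecture.FinalStateConjecture.Cruxes.StripFromProfileDecay.Birth
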